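import Summits.BirchSwinnertonDyer.Rank1Residual.Supersingular.KuriharaTwistSymbolKurihara
import Literature.NumberTheory.EllipticCurves.PAdicLFunctionFrickeSymmetryProofs
import HarnessLib

/-!
# The functional equation of the Kurihara number at ONE prime (`δ_ℓ`): `(1 + w)·δ_ℓ = w·(ψ(−1) − ψ(N))·S_ℓ`
# (cell `b2b-bsdres`, O1 sub-cell `p = 2`; typer item (26b) = lens-4 R-SGN2 (ii) "level-1 Mazur–Tate congruence"; cc-typer-4 GEN 6)

HONEST FRAMING (run/shared/lean/b2b/bsd-rank1-residual/, verbatim in every file): the goal of the cell is to DELETE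
the COMBINATION-SHAPED residual classes of the Birch–Swinnerton-Dyer formula for ALL analytic-rank `≤ 1` elliptic
curves over `ℚ` — "full BSD formula for every rank `≤ 1` curve in class `C`" assembled STRICTLY from published
theorems — so that the rank-`≤ 1` remainder becomes exactly the CONSTRUCTION-SHAPED classes, which are TYPED
(missing-input `Prop`s), NOT attempted. This is not "finishing BSD". THEOREMS only (no `def`, no named fact; nothing
asserted about a particular curve; nothing booked; no RESIDUAL-MAP mark moves). This is BOOKKEEPING for lens-4's
Kurihara line (R-KUR2′ / R-LAW2, `cells/o1/ROUTES-O1.md` §4.36 (b), §4.39; o1 lead R-G20.8: typer item (26b),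
refuter-cleared "provable now"): it "closes the ORDER question negatively" — a single-prime Kurihara number of a
rank-zero curve carries no information on `#Ш` beyond `[0]⁺`.

THE STATEMENT. Let `f ∈ S₂(Γ₀(N))` satisfy the pointwise Fricke eigen-property `f(−1/(Nτ)) = −σ N τ² f(τ)`, `σ = ±1`
(`ModularForms.IsFrickeEigen N f (−σ)`; for the newform of an elliptic curve `σ = w(E)`), let `ℓ ∤ N` be a prime,
`m` ANY modulus and `ψ : (ℤ/ℓ)ˣ → ℤ/m` ANY homomorphism (a discrete logarithm reduced mod `m`; nothing about
`m ∣ ℓ − 1` or surjectivity is needed). With the tree's Kurihara number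
`δ_ℓ(ψ) = Σ_{a ∈ (ℤ/ℓ)ˣ} \overline{[a/ℓ]⁺_f}·ψ(a) ∈ ℤ/m` (`Literature.NumberTheory.EllipticCurves.kuriharaNumber f m ℓ ψ`,
`\overline{q} = ratModP m q`) and `S̄_ℓ = Σ_{a ∈ (ℤ/ℓ)ˣ} \overline{[a/ℓ]⁺_f}`:

  **`(1 + σ)·δ_ℓ(ψ) = σ·(ψ(−1) − ψ(N))·S̄_ℓ`** in `ℤ/m` (`kuriharaNumber_prime_functionalEquation`).

PROOF (Mazur–Tate 1987, §1, the functional equation of the modular element `θ_{ℚ(μ_ℓ)}`; in print as Ota 2018,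
Prop. 5.16 "`θ_S = ε_f δ_{−N}^{−1} ι(θ_S)`" from the symbol relation "`[a/S]^± = ε_f [a'/S]^±`, `a' a N ≡ −1 (mod S)`";
Kim 2022 §3.5 p. 19 "`w(E)·(−1)^{ν(n)}·δ̃_n = δ̃_n`", Prop. 3.16): the Fricke symmetry of the plus symbols — the
tree's `IsFrickeEigen.normalizedPlusSymbol_div_eq_mul` / `ratPlusSymbol_eq_mul_of_normalizedPlusSymbol_eq`, layers
1–2 of the MTT §I.17 functional equation, which need no `α` and no `p` — gives `[a/ℓ]⁺ = σ·[a'/ℓ]⁺` termwise with the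
INVOLUTION `a ↦ a' = −(Na)⁻¹` of `(ℤ/ℓ)ˣ` (§1–§2); reindexing the sum by it and expanding
`ψ(a') = ψ(−1) − ψ(N) − ψ(a)` gives `δ = σ·((ψ(−1) − ψ(N))·S̄ − δ)` (§3). COROLLARIES (§4): `σ = 1` ⇒
`2·δ_ℓ = (ψ(−1) − ψ(N))·S̄_ℓ`; `σ = −1` ⇒ `(ψ(−1) − ψ(N))·S̄_ℓ = 0`. HECKE (§5, for the newform of `E` at a good
`ℓ`, the tree's `hecke_ratPlusSymbol_of_isNewformOf` at `r = 0`): `Σ_{a ∈ (ℤ/ℓ)ˣ} [a/ℓ]⁺ = (a_ℓ(E) − 2)·[0]⁺` EXACTLY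
in `ℚ`, so under `p`-integrality of the symbols `S̄_ℓ = (a_ℓ − 2)·\overline{[0]⁺}` (`m = p^k`). CONSEQUENCES (sibling
file `Supersingular/KuriharaLevelOnePrimePower.lean`):
(i) ODD `p`, `a_ℓ ≡ 2 (mod p^k)` (a Kolyvagin prime, `ℓ ≡ 1`, `a_ℓ ≡ ℓ + 1`), `w = +1`: `δ_ℓ = 0` — Kim's Prop. 3.16
for `ν(n) = 1` as a THEOREM of the tree (`kuriharaNumber_prime_eq_zero_of_odd`); (ii) `p = 2`, `w = +1`, `a_ℓ` EVEN:
**`2·δ_ℓ = −(a_ℓ − 2)·\overline{[0]⁺}·ψ(N)`** in `ℤ/2^k` (`two_mul_kuriharaNumber_prime_eq_neg`) — lens-4's 4.36 (b)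
"`2·D(ℓ) ≡ −(a_ℓ − 2)·x(0)·Log_η(N) (mod 2^{v₂(ℓ−1)})`" (census 4 935 / 4 935, EVIDENCE, not used; their `x` is the
Ω⁺-normalised symbol = the tree's `ratPlusSymbol` up to the lattice/Manin unit; `a_ℓ` even holds at their
admissible `ℓ`, `Frob_ℓ` a transposition on `E[2]`), the term `ψ(−1)·S̄` dying because `2·ψ(−1) = 0` and `S̄` is
even; and at a Kim-admissible `ℓ` (`a_ℓ ≡ 2 (mod 2^k)`) `2·δ_ℓ = 0`: at `p = 2` "−δ = δ" is not vanishing but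
`2`-torsion (`two_mul_kuriharaNumber_prime_eq_zero`). Everything here is exact algebra on the tree's objects; the
Néron-period renormalisation and the choice of `η_ℓ` (a unit rescaling, `kuriharaNumber_eq_prod_mul_kuriharaNumber`)
do not affect any statement.

References: B. Mazur, J. Tate, Duke Math. J. 54 (1987) 711–750, §1; K. Ota, Amer. J. Math. 140 (2018), Prop. 5.16;
C.-H. Kim, arXiv:2203.12159 (Amer. J. Math.), §3.5, Prop. 3.16; B. Mazur, J. Tate, J. Teitelbaum, Invent. Math. 84
(1986), §I.17; M. Kurihara, Iwasawa Theory 2012 (2014), §1.1.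
-/

set_option autoImplicit false

noncomputable section

open scoped Classical MatrixGroups ModularForm

open CongruenceSubgroup Literature.NumberTheory.EllipticCurves Literature.NumberTheory.EllipticCurves.ModularForms
open Literature.NumberTheory.DiophantineGeometry.Dioph (ratModP)

namespace Summit.BirchSwinnertonDyer.Rank1Residual.Supersingular

/-! ## §1. The Fricke reflection `a ↦ −(N a)⁻¹` of `(ℤ/ℓ)ˣ` is an involution -/

section Reflection

variable {M : ℕ}

/-- For units `u, a` of a commutative ring: `−(u · (−(u·a)⁻¹))⁻¹ = a`, i.e. `a ↦ −(u a)⁻¹` is an involution. [folklore] -/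
theorem neg_inv_mul_neg_inv_mul {R : Type*} [CommRing R] (u a : Rˣ) : -(u * -(u * a)⁻¹)⁻¹ = a := by
  rw [mul_neg, inv_neg, neg_neg, mul_inv_rev, inv_inv, mul_comm u a, mul_assoc, mul_inv_cancel, mul_one]

/-- The reflection `a ↦ −(u a)⁻¹` as a permutation of the units. [folklore] -/
theorem involutive_neg_inv_mul {R : Type*} [CommRing R] (u : Rˣ) :
    Function.Involutive (fun a : Rˣ => -(u * a)⁻¹) :=
  fun a => neg_inv_mul_neg_inv_mul u a

/-- The defining congruence of the reflection: `u · a · a' = −1` for `a' = −(u a)⁻¹`. [folklore] -/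
theorem mul_mul_neg_inv_mul {R : Type*} [CommRing R] (u a : Rˣ) : u * a * -(u * a)⁻¹ = -1 := by
  rw [mul_neg, mul_inv_cancel]

end Reflection

/-! ## §2. Fricke symmetry of the weights `a ↦ [a/M]⁺` at any modulus `M` prime to `N` -/

section Fricke

variable {N : ℕ} [NeZero N] {f : CuspForm (Gamma0 N) 2}

/-- **`[u/M]⁺ = σ [u'/M]⁺` whenever `N u u' ≡ −1 (mod M)`**, for the rational plus symbols of a form with
`f(−1/(Nτ)) = −σ N τ² f(τ)`, `σ² = 1`, any modulus `M ≥ 1` (the general-modulus twin of the tree's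
`ratPlusSymbol_val_div_eq_mul_of_isFrickeEigen`, stated there for `M = p^L`; same proof: representatives
`a = u.val`, `b = u'.val` satisfy `A·M − a·N·b = 1`, then `IsFrickeEigen.normalizedPlusSymbol_div_eq_mul` and
`ratPlusSymbol_eq_mul_of_normalizedPlusSymbol_eq`). Ota 2018, display before Prop. 5.16: "`[a/S]^± = ε_f [a'/S]^±`
where `a' a N ≡ −1 mod S`". [cite: Ota2018, §5.5 (display before Prop. 5.16)] [cite: MazurTateTeitelbaum1986Invent, §I.17] -/
theorem ratPlusSymbol_val_div_eq_mul_of_isFrickeEigen_mod {σ : ℤ} (hσ : σ ^ 2 = 1)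
    (hW : IsFrickeEigen N f (-(σ : ℂ))) {M : ℕ} [NeZero M] {u u' : ZMod M}
    (h : (N : ZMod M) * u * u' = -1) :
    ratPlusSymbol f ((u.val : ℚ) / (M : ℚ)) = σ * ratPlusSymbol f ((u'.val : ℚ) / (M : ℚ)) := by
  have hdvd : ((M : ℕ) : ℤ) ∣ (N : ℤ) * u.val * u'.val + 1 := by
    rw [← ZMod.intCast_zmod_eq_zero_iff_dvd]
    push_cast
    rw [ZMod.natCast_zmod_val, ZMod.natCast_zmod_val, h, neg_add_cancel]
  obtain ⟨A, hA⟩ := hdvd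
  have h1 : A * ((M : ℕ) : ℤ) - (u.val : ℤ) * (N * (u'.val : ℤ)) = 1 := by
    linear_combination -hA
  have k := ratPlusSymbol_eq_mul_of_normalizedPlusSymbol_eq f hσ
    (hW.normalizedPlusSymbol_div_eq_mul hσ (Nat.pos_of_ne_zero (NeZero.ne M)) h1)
  exact k

end Fricke

/-! ## §3. The functional equation of `δ_ℓ` -/

section FunctionalEquation

variable {N : ℕ} [NeZero N] (f : CuspForm (Gamma0 N) 2) {ℓ : ℕ} [hℓ : Fact ℓ.Prime] (m : ℕ)

/-- `ratModP m (−q) = −ratModP m q` (no integrality needed: `num (−q) = −num q`, `den (−q) = den q`). [folklore] -/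
theorem ratModP_neg' (q : ℚ) : ratModP m (-q) = -ratModP m q := by
  rw [ratModP_def, ratModP_def, Rat.num_neg_eq_neg_num, Rat.den_neg_eq_den, Int.cast_neg, neg_mul]

/-- `ratModP m (σ q) = σ · ratModP m q` for `σ = ±1`. [folklore] -/
theorem ratModP_intCast_mul_of_sq_eq_one {σ : ℤ} (hσ : σ ^ 2 = 1) (q : ℚ) :
    ratModP m (σ * q) = (σ : ZMod m) * ratModP m q := by
  rcases sq_eq_one_iff.mp hσ with h | h
  · subst h; simp
  · subst h
    rw [Int.cast_neg, Int.cast_one, neg_one_mul, ratModP_neg', Int.cast_neg, Int.cast_one, neg_one_mul]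

omit [NeZero N] in
/-- **The Kurihara number at a single prime `ℓ`, unfolded**: `δ_ℓ(ψ) = Σ_{a ∈ (ℤ/ℓ)ˣ} \overline{[a/ℓ]⁺}·ψ_ℓ(a)`
(the product over the prime factors of `ℓ` is the single factor `ψ_ℓ(a)`). [folklore] -/
theorem kuriharaNumber_prime_eq_sum (ψ : (q : ℕ) → (ZMod q)ˣ →* Multiplicative (ZMod m)) :
    kuriharaNumber f m ℓ ψ =
      ∑ a : (ZMod ℓ)ˣ, ratModP m (ratPlusSymbol f ((((a : ZMod ℓ).val : ℕ) : ℚ) / (ℓ : ℚ))) *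
        Multiplicative.toAdd (ψ ℓ a) := by
  rw [kuriharaNumber_def]
  refine Finset.sum_congr rfl fun a _ => ?_
  congr 1
  have hmem : ℓ ∈ ℓ.primeFactors := Nat.mem_primeFactors.mpr ⟨hℓ.out, dvd_refl ℓ, hℓ.out.ne_zero⟩
  have huniq : ∀ x : {x // x ∈ ℓ.primeFactors}, (x : ℕ) = ℓ := fun x =>
    (Nat.prime_dvd_prime_iff_eq (Nat.prime_of_mem_primeFactors x.2) hℓ.out).mp
      (Nat.dvd_of_mem_primeFactors x.2)
  haveI : Subsingleton {x // x ∈ ℓ.primeFactors} :=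
    ⟨fun x y => Subtype.ext ((huniq x).trans (huniq y).symm)⟩
  rw [← Finset.univ_eq_attach, Fintype.prod_subsingleton _ ⟨ℓ, hmem⟩]
  change Multiplicative.toAdd (ψ ℓ (ZMod.unitsMap (dvd_refl ℓ) a)) = _
  rw [ZMod.unitsMap_self, MonoidHom.id_apply]

/-- **FUNCTIONAL EQUATION OF `δ_ℓ` (Mazur–Tate): `(1 + σ)·δ_ℓ(ψ) = σ·(ψ(−1) − ψ(N))·Σ_a \overline{[a/ℓ]⁺}`** in `ℤ/m`,
for `f` with `f(−1/(Nτ)) = −σ N τ² f(τ)` (`σ² = 1`), a prime `ℓ ∤ N` (`N` read as the unit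
`ZMod.unitOfCoprime N _` of `ℤ/ℓ`), ANY modulus `m` and ANY homomorphism `ψ_ℓ : (ℤ/ℓ)ˣ → ℤ/m`. Reindex `δ_ℓ` by
the involution `a ↦ a' = −(N a)⁻¹`, use `[a/ℓ]⁺ = σ [a'/ℓ]⁺` termwise and `ψ(a') = ψ(−1) − ψ(N) − ψ(a)`.
[cite: Ota2018, Prop. 5.16] [cite: Kim2022StructureSelmer, §3.5 (PDF p. 19)] -/
theorem kuriharaNumber_prime_functionalEquation {σ : ℤ} (hσ : σ ^ 2 = 1)
    (hW : IsFrickeEigen N f (-(σ : ℂ))) (hℓN : ¬ ℓ ∣ N)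
    (ψ : (q : ℕ) → (ZMod q)ˣ →* Multiplicative (ZMod m)) :
    ((1 + σ : ℤ) : ZMod m) * kuriharaNumber f m ℓ ψ =
      (σ : ZMod m) * ((Multiplicative.toAdd (ψ ℓ (-1)) -
          Multiplicative.toAdd (ψ ℓ (ZMod.unitOfCoprime N ((Nat.coprime_comm).mp
            ((Nat.Prime.coprime_iff_not_dvd hℓ.out).mpr hℓN))))) *
        ∑ a : (ZMod ℓ)ˣ, ratModP m (ratPlusSymbol f ((((a : ZMod ℓ).val : ℕ) : ℚ) / (ℓ : ℚ)))) := by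
  set u : (ZMod ℓ)ˣ := ZMod.unitOfCoprime N ((Nat.coprime_comm).mp
    ((Nat.Prime.coprime_iff_not_dvd hℓ.out).mpr hℓN)) with hu
  have huval : (u : ZMod ℓ) = N := ZMod.coe_unitOfCoprime N _
  -- the weights and their Fricke symmetry
  set w : (ZMod ℓ)ˣ → ZMod m :=
    fun a => ratModP m (ratPlusSymbol f ((((a : ZMod ℓ).val : ℕ) : ℚ) / (ℓ : ℚ))) with hw
  have hsymm : ∀ a : (ZMod ℓ)ˣ, w a = (σ : ZMod m) * w (-(u * a)⁻¹) := by
    intro a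
    have hcong : (N : ZMod ℓ) * (a : ZMod ℓ) * ((-(u * a)⁻¹ : (ZMod ℓ)ˣ) : ZMod ℓ) = -1 := by
      have h := congrArg (Units.val : (ZMod ℓ)ˣ → ZMod ℓ) (mul_mul_neg_inv_mul u a)
      rw [Units.val_mul, Units.val_mul, huval] at h
      rw [h, Units.val_neg, Units.val_one]
    have k := ratPlusSymbol_val_div_eq_mul_of_isFrickeEigen_mod (f := f) hσ hW (M := ℓ) hcong
    show ratModP m _ = (σ : ZMod m) * ratModP m _
    rw [k, ratModP_intCast_mul_of_sq_eq_one m hσ]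
  -- the logarithm of the reflected unit
  have hlog : ∀ a : (ZMod ℓ)ˣ, Multiplicative.toAdd (ψ ℓ (-(u * a)⁻¹)) =
      Multiplicative.toAdd (ψ ℓ (-1)) - Multiplicative.toAdd (ψ ℓ u) - Multiplicative.toAdd (ψ ℓ a) := by
    intro a
    rw [show (-(u * a)⁻¹ : (ZMod ℓ)ˣ) = -1 * (u⁻¹ * a⁻¹) by rw [mul_inv, neg_one_mul], map_mul (ψ ℓ),
      map_mul (ψ ℓ), map_inv (ψ ℓ), map_inv (ψ ℓ), toAdd_mul, toAdd_mul, toAdd_inv, toAdd_inv]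
    abel
  -- reindex `δ` by the involution
  set e : Equiv.Perm (ZMod ℓ)ˣ := Function.Involutive.toPerm _ (involutive_neg_inv_mul u) with he
  have hδ : kuriharaNumber f m ℓ ψ = ∑ a : (ZMod ℓ)ˣ, w a * Multiplicative.toAdd (ψ ℓ a) :=
    kuriharaNumber_prime_eq_sum f m ψ
  have hre : ∑ a : (ZMod ℓ)ˣ, w a * Multiplicative.toAdd (ψ ℓ a) =
      ∑ a : (ZMod ℓ)ˣ, (σ : ZMod m) * w (e a) *
        (Multiplicative.toAdd (ψ ℓ (-1)) - Multiplicative.toAdd (ψ ℓ u) -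
          Multiplicative.toAdd (ψ ℓ (e a))) := by
    refine Finset.sum_congr rfl fun a _ => ?_
    have hea : e a = -(u * a)⁻¹ := rfl
    rw [hea, hsymm a, hlog]
    -- `ψ(a) = ψ(−1) − ψ(u) − ψ(a')` is `hlog` read at `a'` with `a'' = a`
    have h2 := hlog (-(u * a)⁻¹)
    rw [neg_inv_mul_neg_inv_mul] at h2
    rw [h2]
    ring
  have hsum : ∑ a : (ZMod ℓ)ˣ, (σ : ZMod m) * w (e a) *
        (Multiplicative.toAdd (ψ ℓ (-1)) - Multiplicative.toAdd (ψ ℓ u) -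
          Multiplicative.toAdd (ψ ℓ (e a))) =
      ∑ b : (ZMod ℓ)ˣ, (σ : ZMod m) * w b *
        (Multiplicative.toAdd (ψ ℓ (-1)) - Multiplicative.toAdd (ψ ℓ u) -
          Multiplicative.toAdd (ψ ℓ b)) :=
    Equiv.sum_comp e (fun b => (σ : ZMod m) * w b *
        (Multiplicative.toAdd (ψ ℓ (-1)) - Multiplicative.toAdd (ψ ℓ u) -
          Multiplicative.toAdd (ψ ℓ b)))
  -- assemble: `δ = σ·(c·S̄ − δ)`
  have key : kuriharaNumber f m ℓ ψ =
      (σ : ZMod m) * ((Multiplicative.toAdd (ψ ℓ (-1)) - Multiplicative.toAdd (ψ ℓ u)) *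
        ∑ a : (ZMod ℓ)ˣ, w a) - (σ : ZMod m) * kuriharaNumber f m ℓ ψ := by
    conv_lhs => rw [hδ, hre, hsum]
    rw [hδ, Finset.mul_sum, Finset.mul_sum, Finset.mul_sum, ← Finset.sum_sub_distrib]
    refine Finset.sum_congr rfl fun b _ => ?_
    ring
  push_cast
  linear_combination key

end FunctionalEquation

/-! ## §4. The two signs -/

section Signs

variable {N : ℕ} [NeZero N] (f : CuspForm (Gamma0 N) 2) {ℓ : ℕ} [hℓ : Fact ℓ.Prime] (m : ℕ)

/-- **`σ = +1` (even functional equation, `w(E) = +1`): `2·δ_ℓ(ψ) = (ψ(−1) − ψ(N))·S̄_ℓ`.** [cite: Ota2018, Prop. 5.16] -/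
theorem two_mul_kuriharaNumber_prime_eq (hW : IsFrickeEigen N f (-(1 : ℂ))) (hℓN : ¬ ℓ ∣ N)
    (ψ : (q : ℕ) → (ZMod q)ˣ →* Multiplicative (ZMod m)) :
    (2 : ZMod m) * kuriharaNumber f m ℓ ψ =
      (Multiplicative.toAdd (ψ ℓ (-1)) -
          Multiplicative.toAdd (ψ ℓ (ZMod.unitOfCoprime N ((Nat.coprime_comm).mp
            ((Nat.Prime.coprime_iff_not_dvd hℓ.out).mpr hℓN))))) *
        ∑ a : (ZMod ℓ)ˣ, ratModP m (ratPlusSymbol f ((((a : ZMod ℓ).val : ℕ) : ℚ) / (ℓ : ℚ))) := by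
  have h := kuriharaNumber_prime_functionalEquation f m (σ := 1) (by norm_num) (by simpa using hW) hℓN ψ
  simpa [one_add_one_eq_two] using h

/-- **`σ = −1` (odd functional equation, `w(E) = −1`): `(ψ(−1) − ψ(N))·S̄_ℓ = 0`** (no constraint on `δ_ℓ`:
Kim's Prop. 3.16 is silent when `(−1)^{ν(n)} = w(E)`). [cite: Ota2018, Prop. 5.16] -/
theorem sub_mul_sum_ratModP_eq_zero_of_neg (hW : IsFrickeEigen N f (-((-1 : ℤ) : ℂ))) (hℓN : ¬ ℓ ∣ N)
    (ψ : (q : ℕ) → (ZMod q)ˣ →* Multiplicative (ZMod m)) :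
    (Multiplicative.toAdd (ψ ℓ (-1)) -
          Multiplicative.toAdd (ψ ℓ (ZMod.unitOfCoprime N ((Nat.coprime_comm).mp
            ((Nat.Prime.coprime_iff_not_dvd hℓ.out).mpr hℓN))))) *
        ∑ a : (ZMod ℓ)ˣ, ratModP m (ratPlusSymbol f ((((a : ZMod ℓ).val : ℕ) : ℚ) / (ℓ : ℚ))) = 0 := by
  have h := kuriharaNumber_prime_functionalEquation f m (σ := -1) (by norm_num) hW hℓN ψ
  simp only [Int.reduceNeg, Int.cast_neg, Int.cast_one, neg_mul, one_mul] at h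
  have h' : ((1 + -1 : ℤ) : ZMod m) = 0 := by norm_num
  rw [h', zero_mul] at h
  exact neg_eq_zero.mp h.symm

end Signs

/-! ## §5. Hecke: `Σ_{a ∈ (ℤ/ℓ)ˣ} [a/ℓ]⁺ = (a_ℓ(E) − 2)·[0]⁺` for the newform of `E` at a good prime `ℓ` -/

section Hecke

open KuriharaTwist.Identity

variable {N : ℕ} [NeZero N] {f : CuspForm (Gamma0 N) 2}
  {W : WeierstrassCurve ℚ} [W.IsElliptic] [W.IsGloballyMinimal]

/-- Sum over `ℤ/ℓ` of a function of the representative `val ∈ [0, ℓ)` = sum over `Fin ℓ`. [folklore] -/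
theorem sum_zmod_val_eq_sum_fin {ℓ : ℕ} [NeZero ℓ] {M : Type*} [AddCommMonoid M] (g : ℕ → M) :
    ∑ x : ZMod ℓ, g x.val = ∑ j : Fin ℓ, g (j : ℕ) := by
  obtain ⟨k, rfl⟩ : ∃ k, ℓ = k + 1 := Nat.exists_eq_succ_of_ne_zero (NeZero.ne ℓ)
  rfl

/-- Sum over the units of the field `ℤ/ℓ` = sum over `ℤ/ℓ` minus the term at `0`. [folklore] -/
theorem sum_units_eq_sum_sub {ℓ : ℕ} [Fact ℓ.Prime] {M : Type*} [AddCommGroup M] (g : ZMod ℓ → M) :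
    ∑ a : (ZMod ℓ)ˣ, g (a : ZMod ℓ) = (∑ x : ZMod ℓ, g x) - g 0 := by
  rw [eq_sub_iff_add_eq]
  have h : ∑ x : ZMod ℓ, g x = g 0 + ∑ x ∈ Finset.univ.erase (0 : ZMod ℓ), g x :=
    (Finset.add_sum_erase _ _ (Finset.mem_univ _)).symm
  rw [h, add_comm]
  congr 1
  refine Finset.sum_bij' (fun a _ => (a : ZMod ℓ)) (fun x hx => Units.mk0 x (Finset.ne_of_mem_erase hx))
    (fun a _ => Finset.mem_erase.mpr ⟨a.ne_zero, Finset.mem_univ _⟩) (fun x hx => Finset.mem_univ _)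
    (fun a _ => Units.ext rfl) (fun x hx => rfl) (fun a _ => rfl)

/-- **Hecke at the cusp `0`: `Σ_{a ∈ (ℤ/ℓ)ˣ} [a/ℓ]⁺_f = (a_ℓ(E) − 2)·[0]⁺_f`** for the newform `f` of `E = W` and a
prime `ℓ` of good reduction (`a_ℓ·[0]⁺ = Σ_{j=0}^{ℓ−1} [j/ℓ]⁺ + [0]⁺`, the tree's `hecke_ratPlusSymbol_of_isNewformOf`
at `r = 0`; the `j = 0` term is `[0]⁺`). [folklore] -/
theorem sum_units_ratPlusSymbol_div_eq (hf : IsNewformOf W f) {ℓ : ℕ} [hℓ : Fact ℓ.Prime]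
    (hgood : W.HasGoodReductionAtPrime ℓ) :
    ∑ a : (ZMod ℓ)ˣ, ratPlusSymbol f ((((a : ZMod ℓ).val : ℕ) : ℚ) / (ℓ : ℚ)) =
      ((W.frobeniusTrace ℓ : ℚ) - 2) * ratPlusSymbol f 0 := by
  have h := hecke_ratPlusSymbol_of_isNewformOf hf hgood (0 : ℚ)
  simp only [zero_add, mul_zero] at h
  have hfin : ∑ j : Fin ℓ, ratPlusSymbol f ((((j : ℕ) : ℚ)) / (ℓ : ℚ)) =
      ∑ x : ZMod ℓ, ratPlusSymbol f (((x.val : ℕ) : ℚ) / (ℓ : ℚ)) :=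
    (sum_zmod_val_eq_sum_fin (ℓ := ℓ) (fun n => ratPlusSymbol f (((n : ℕ) : ℚ) / (ℓ : ℚ)))).symm
  rw [sum_units_eq_sum_sub (fun x : ZMod ℓ => ratPlusSymbol f (((x.val : ℕ) : ℚ) / (ℓ : ℚ))),
    ← hfin, ZMod.val_zero, Nat.cast_zero, zero_div]
  linear_combination -h

end Hecke


end Summit.BirchSwinnertonDyer.Rank1Residual.Supersingular

end
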